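import Summits.Ventures.PercRepro.ProfilePointedCircuitClassesTwelveQuadA

/-!
# PercRepro — THE TWELVE-POINT STATEMENT `InOutBottomTwelve` WHEN EVERY CO-RANK-2 QUADRUPLE CONTAINS A SERIES TRIPLE, II:
THE DEFICIENT DEMANDS, THE ASSEMBLY, THE TRANSFER (p5, gen 43; `proofs/P5-GM1.md` §65)

Part I (ProfilePointedCircuitClassesTwelveQuadA) set up the weights `pwt60` (`60 / p(U)` on a disjoint pair, `15`
for a `(2,0)`-unit, `5` on a clean pair of a deficient demand with a `(2,0)`-unit), bounded every unit by `60`, gave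
every demand with at least five non-coloops `60`, and excluded the demands with exactly four non-coloops under the
hypothesis «every four points of rank `2` of the dual contain three pairwise parallel points».  HERE: a deficient
demand (`B = K ⊔ P`, `P` a parallel triple) sends at least `60` through its three disjoint units `B − p` (common
weight `wt`) and, when `3·wt < 60`, the clean units `K + p + w` of one or two substitution points `w ∈ cw(W) ∖ S`
(`sixty_le_sum_pwt60_of_deficient`); the assembly `60·#𝒟 ≤ Σ pwt60 ≤ 60·#𝒰` (`card_pdem_le_card_punit_of_quad`);
the dual rank formula `ρ✶(X) + ρ(E) = ρ(E ∖ X) + #X` (`rk_dual_add_rk_gr_eq`); and the transfer to `N`: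
**`inCount_five_le_outCount_six_of_twelve_of_quad`** — `in_5(e) ≤ out_6(e)` on every matroid with `12` points and
rank `7` in which every `4`-set `D` with `ρ(E ∖ D) = 5` contains a `3`-set `P` with `ρ(E ∖ P) = 5`.
-/

open scoped Matroid

namespace PercRepro.Cogirth

open Finset ThmH Skew Shadow Profile

variable {α : Type} [DecidableEq α] {M : Matroid α} [M.Finite]

section TwelveQuadB

/-- `#(cw(W, p) ∖ S) ≤ 4` for a demand `W ⊇ S` with `#S = 1` (`cw ⊆ W`, five points). -/
theorem card_cw_sdiff_le_four {S W : Finset α} (hW : W ∈ pdem M S) (hS1 : S.card = 1) (p : α) :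
    (cw M W p \ S).card ≤ 4 := by
  obtain ⟨_, hW5, hSW, _, _⟩ := mem_pdem.1 hW
  calc (cw M W p \ S).card ≤ (W \ S).card := card_le_card (sdiff_subset_sdiff (filter_subset _ _) (Subset.refl _))
    _ = 4 := by rw [card_sdiff_of_subset hSW, hW5, hS1]

/-- **THE DEFICIENT DEMANDS' SIDE `×60`**: a deficient demand (`B = K ⊔ P`, `P` a parallel triple) sends at least
`60`: its three disjoint units `B − p` carry a common weight `wt`, and when `3·wt < 60` (`wt = 15`: a `(2,0)`-unit
or `#(cw ∖ S) = 3`; `wt = 12`: `#(cw ∖ S) = 4`) one or two points `w ∈ cw(W) ∖ S` supply three clean units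
`K + p + w` each, of weight `5`. -/
theorem sixty_le_sum_pwt60_of_deficient (hn : (gr M).card = 12) (hR : rk M (gr M) = 5)
    (hll : ∀ x ∈ gr M, rk M {x} = 1) {S : Finset α} (hS1 : S.card = 1) {W : Finset α}
    (hW : W ∈ pdem M S) (hd : deficient M W) : 60 ≤ ∑ U ∈ punit M S, pwt60 M S W U := by
  obtain ⟨hWg, hW5, hSW, hWr, hWc⟩ := mem_pdem.1 hW
  obtain ⟨hc3, hr1⟩ := nonco_card_eq_three_of_deficient hn hll hW hd
  have hBg : gr M \ W ⊆ gr M := sdiff_subset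
  have hncB : nonco M W ⊆ gr M \ W := filter_subset _ _
  have hncg : nonco M W ⊆ gr M := hncB.trans hBg
  obtain ⟨p₀, hp₀⟩ : (nonco M W).Nonempty := card_pos.1 (by omega)
  -- the three disjoint units `B − p` carry the common weight `wt`
  set wt : ℕ := (if (cw M W p₀).card = 1 ∧ cw M W p₀ ∩ S = ∅ then 15 else 60 / ((cw M W p₀ \ S).card + 1))
    with hwt
  have hcw : ∀ p ∈ nonco M W, cw M W p = cw M W p₀ := fun p hp =>
    cw_eq_of_parallel hll hWg (hncg hp) (hncg hp₀) (rk_pair_le_one_of_mem_nonco hn hll hW hd hp hp₀)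
  have hwtp : ∀ p ∈ nonco M W, pwt60 M S W ((gr M \ W).erase p) = wt := by
    intro p hp
    rw [pwt60_erase_eq hW hp, hcw p hp]
  have hF₁ : (nonco M W).image (fun p => (gr M \ W).erase p) ⊆ punit M S := by
    rw [← filter_punit_inter_eq_image hn hR hW]
    exact filter_subset _ _
  have hinj₁ : Set.InjOn (fun p => (gr M \ W).erase p) (nonco M W) :=
    fun p hp p' hp' h => (gr M \ W).erase_injOn (hncB (mem_coe.1 hp)) (hncB (mem_coe.1 hp')) h
  have hsum₁ : ∑ U ∈ (nonco M W).image (fun p => (gr M \ W).erase p), pwt60 M S W U = 3 * wt := by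
    rw [sum_image hinj₁, sum_congr rfl hwtp, sum_const, hc3, smul_eq_mul]
  rcases Nat.lt_or_ge (3 * wt) 60 with hlt | hge
  · -- `3·wt < 60`: `wt ∈ {15, 12}` and the clean units are needed
    have hm4 := card_cw_sdiff_le_four hW hS1 p₀
    -- the number `k` of points `w` to use: `1` if `60 ≤ 3·wt + 15`, else `2`
    have hk : ∃ k, 1 ≤ k ∧ k ≤ (cw M W p₀ \ S).card ∧ 60 ≤ 3 * wt + 15 * k := by
      rw [hwt] at hlt ⊢
      split_ifs at hlt ⊢ with h20
      · -- `wt = 15`, `cw ∖ S = cw` has one point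
        refine ⟨1, le_refl 1, ?_, by norm_num⟩
        have : cw M W p₀ \ S = cw M W p₀ := by
          rw [Finset.sdiff_eq_self_iff_disjoint, disjoint_iff_inter_eq_empty]
          exact h20.2
        rw [this, h20.1]
      · -- `wt = 60 / (m + 1) < 20`, so `m ≥ 3`; `m ≤ 4`
        have hm3 : 3 ≤ (cw M W p₀ \ S).card := by
          by_contra hlt3
          have : (cw M W p₀ \ S).card ≤ 2 := by omega
          interval_cases (cw M W p₀ \ S).card <;> norm_num at hlt
        interval_cases (cw M W p₀ \ S).card
        · exact ⟨1, by norm_num, by norm_num, by norm_num⟩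
        · exact ⟨2, by norm_num, by norm_num, by norm_num⟩
    obtain ⟨k, hk1, hkm, hk60⟩ := hk
    obtain ⟨T, hTsub, hTk⟩ := exists_subset_card_eq (s := cw M W p₀ \ S) (n := k) hkm
    -- the clean units `K + p + w`, `p ∈ nonco(W)`, `w ∈ T`
    have hcl : ∀ p ∈ nonco M W, ∀ w ∈ T,
        insert w (insert p ((gr M \ W) \ nonco M W)) ∈ punit M S ∧
          pwt60 M S W (insert w (insert p ((gr M \ W) \ nonco M W))) = 5 := by
      intro p hp w hw
      have h := clean_unit_facts hn hR hll hW hd hp (by rw [hcw p hp]; exact hTsub hw)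
      exact ⟨h.1, pwt60_eq_five_of_pwt_eq_one hn h.1 h.2⟩
    have hTW : T ⊆ W := fun w hw => (filter_subset _ _ (mem_sdiff.1 (hTsub hw)).1)
    let V : α × α → Finset α := fun q => insert q.2 (insert q.1 ((gr M \ W) \ nonco M W))
    have hF₂ : ((nonco M W) ×ˢ T).image V ⊆ punit M S := by
      intro U hU
      obtain ⟨q, hq, rfl⟩ := mem_image.1 hU
      rw [mem_product] at hq
      exact (hcl q.1 hq.1 q.2 hq.2).1
    have hinj₂ : Set.InjOn V (((nonco M W) ×ˢ T : Finset (α × α)) : Set (α × α)) := by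
      intro q hq q' hq' h
      rw [mem_coe, mem_product] at hq hq'
      simp only [V] at h
      have hpW : q.1 ∉ W := (mem_sdiff.1 (hncB hq.1)).2
      have hp'W : q'.1 ∉ W := (mem_sdiff.1 (hncB hq'.1)).2
      have hpK : q.1 ∉ (gr M \ W) \ nonco M W := fun h' => (mem_sdiff.1 h').2 hq.1
      have hwW : q.2 ∈ W := hTW hq.2
      have hw'W : q'.2 ∈ W := hTW hq'.2
      have hwK : q.2 ∉ (gr M \ W) \ nonco M W := fun h' => (mem_sdiff.1 (mem_sdiff.1 h').1).2 hwW
      -- `q.2 ∈ V q'` gives `q.2 = q'.2`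
      have h1 : q.2 ∈ insert q'.2 (insert q'.1 ((gr M \ W) \ nonco M W)) := by
        rw [← h]; exact mem_insert_self _ _
      rw [mem_insert, mem_insert] at h1
      have hw : q.2 = q'.2 := by
        rcases h1 with h1 | h1 | h1
        · exact h1
        · exact absurd (h1 ▸ hwW) hp'W
        · exact absurd h1 hwK
      -- `q.1 ∈ V q'` gives `q.1 = q'.1`
      have h2 : q.1 ∈ insert q'.2 (insert q'.1 ((gr M \ W) \ nonco M W)) := by
        rw [← h]; exact mem_insert_of_mem (mem_insert_self _ _)
      rw [mem_insert, mem_insert] at h2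
      have hp : q.1 = q'.1 := by
        rcases h2 with h2 | h2 | h2
        · exact absurd (h2 ▸ hw'W) hpW
        · exact h2
        · exact absurd h2 hpK
      exact Prod.ext hp hw
    have hval : ∀ q ∈ (nonco M W) ×ˢ T, pwt60 M S W (V q) = 5 := by
      intro q hq
      rw [mem_product] at hq
      exact (hcl q.1 hq.1 q.2 hq.2).2
    have hsum₂ : ∑ U ∈ ((nonco M W) ×ˢ T).image V, pwt60 M S W U = 15 * k := by
      rw [sum_image hinj₂, sum_congr rfl hval, sum_const, card_product, hc3, hTk, smul_eq_mul]
      ring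
    have hdisj : Disjoint ((nonco M W).image (fun p => (gr M \ W).erase p)) (((nonco M W) ×ˢ T).image V) := by
      rw [disjoint_left]
      intro U hU₁ hU₂
      obtain ⟨p, _, rfl⟩ := mem_image.1 hU₁
      obtain ⟨q, hq, hq'⟩ := mem_image.1 hU₂
      rw [mem_product] at hq
      have : q.2 ∈ (gr M \ W).erase p := by rw [← hq']; exact mem_insert_self _ _
      exact (mem_sdiff.1 (erase_subset _ _ this)).2 (hTW hq.2)
    calc 60 ≤ 3 * wt + 15 * k := hk60
      _ = ∑ U ∈ (nonco M W).image (fun p => (gr M \ W).erase p) ∪ ((nonco M W) ×ˢ T).image V,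
            pwt60 M S W U := by
          rw [sum_union hdisj, hsum₁, hsum₂]
      _ ≤ ∑ U ∈ punit M S, pwt60 M S W U := sum_le_sum_of_subset (union_subset hF₁ hF₂)
  · calc 60 ≤ 3 * wt := hge
      _ = ∑ U ∈ (nonco M W).image (fun p => (gr M \ W).erase p), pwt60 M S W U := hsum₁.symm
      _ ≤ ∑ U ∈ punit M S, pwt60 M S W U := sum_le_sum_of_subset hF₁

/-- **THE POINT INEQUALITY IN THE DUAL, QUAD REGIME**: on a loopless matroid of rank `5` with `12` points in which
every four points of rank `2` contain three pairwise parallel points, for every singleton `S ⊆ E` the bases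
`W ⊇ S` with spanning complement are at most the spanning `6`-sets avoiding `S` with spanning complement
(`60·#𝒟 ≤ Σ pwt60 ≤ 60·#𝒰`). -/
theorem card_pdem_le_card_punit_of_quad (hn : (gr M).card = 12) (hR : rk M (gr M) = 5)
    (hll : ∀ x ∈ gr M, rk M {x} = 1)
    (hq : ∀ D ⊆ gr M, D.card = 4 → rk M D = 2 → ∃ P ⊆ D, P.card = 3 ∧ rk M P = 1)
    {S : Finset α} (hS : S ⊆ gr M) (hS1 : S.card = 1) : (pdem M S).card ≤ (punit M S).card := by
  have h1 : 60 * (pdem M S).card ≤ ∑ W ∈ pdem M S, ∑ U ∈ punit M S, pwt60 M S W U := by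
    rw [mul_comm, ← smul_eq_mul]
    apply card_nsmul_le_sum
    intro W hW
    by_cases hd : deficient M W
    · exact sixty_le_sum_pwt60_of_deficient hn hR hll hS1 hW hd
    · have h4 : 4 ≤ (nonco M W).card := by unfold deficient at hd; omega
      have hne := nonco_card_ne_four_of_quad hn hq hW
      exact sixty_le_sum_pwt60_of_five_le hn hR hS hS1 hW (by omega)
  have h2 : ∑ W ∈ pdem M S, ∑ U ∈ punit M S, pwt60 M S W U ≤ 60 * (punit M S).card := by
    rw [sum_comm, mul_comm, ← smul_eq_mul]
    apply sum_le_card_nsmul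
    intro U hU
    exact sum_pwt60_le_sixty hn hR hS hU
  omega

end TwelveQuadB

section TwelveQuadTransfer

variable {N : Matroid α} [N.Finite]

/-- The dual rank of a subset: `ρ✶(X) + ρ(E) = ρ(E ∖ X) + #X` (Mathlib's `Matroid.eRk_dual_add_eRank`). -/
theorem rk_dual_add_rk_gr_eq {X : Finset α} (hX : X ⊆ gr N) :
    rk (N✶) X + rk N (gr N) = rk N (gr N \ X) + X.card := by
  have hXE : (X : Set α) ⊆ N.E := by rw [← coe_gr]; exact_mod_cast hX
  have h := Matroid.eRk_dual_add_eRank N (X : Set α) hXE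
  rw [← coe_gr, ← Finset.coe_sdiff, ← coe_rk, ← coe_rk, eRank_eq_coe_rk,
    Set.encard_coe_eq_coe_finsetCard] at h
  have h' : ((rk (N✶) X + rk N (gr N) : ℕ) : ℕ∞) = ((rk N (gr N \ X) + X.card : ℕ) : ℕ∞) := by
    push_cast
    exact h
  exact Nat.cast_injective h'

/-- **THE QUAD REGIME ON COLOOP-FREE GROUND SETS**: `#E = 12`, `ρ(E) = 7`, no coloops, and every `4`-set `D` with
`ρ(E ∖ D) = 5` contains a `3`-set `P` with `ρ(E ∖ P) = 5` ⟹ `in_5(e) ≤ out_6(e)` at every point `e` (the dual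
count `card_pdem_le_card_punit_of_quad` for `S = {e}`). -/
theorem inCount_five_le_outCount_six_of_twelve_of_cf_of_quad (hn : (gr N).card = 12)
    (hR7 : rk N (gr N) = 7) (hcf : ∀ x ∈ gr N, rk N ((gr N).erase x) = rk N (gr N))
    (hq : ∀ D ⊆ gr N, D.card = 4 → rk N (gr N \ D) = 5 → ∃ P ⊆ D, P.card = 3 ∧ rk N (gr N \ P) = 5)
    {e : α} (he : e ∈ gr N) : inCount N 5 e ≤ outCount N 6 e := by
  have hR : rk (N✶) (gr (N✶)) = 5 := by
    rw [gr_dual]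
    have := rk_dual_add_rk (M := N)
    omega
  have hll : ∀ x ∈ gr (N✶), rk (N✶) {x} = 1 := by
    intro x hx
    rw [gr_dual] at hx
    have h := (rk_dual_eq_card_iff (singleton_subset_iff.2 hx)).2 (by
      rw [sdiff_singleton_eq_erase]; exact hcf x hx)
    rw [h, card_singleton]
  have h12 : (gr (N✶)).card = 12 := by rw [gr_dual]; exact hn
  have hSd : ({e} : Finset α) ⊆ gr (N✶) := by rw [gr_dual]; exact singleton_subset_iff.2 he
  -- the hypothesis in the dual: four points of rank `2` contain three of rank `1`
  have hqd : ∀ D ⊆ gr (N✶), D.card = 4 → rk (N✶) D = 2 → ∃ P ⊆ D, P.card = 3 ∧ rk (N✶) P = 1 := by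
    intro D hD hD4 hDr
    rw [gr_dual] at hD
    have h1 := rk_dual_add_rk_gr_eq hD
    obtain ⟨P, hPD, hP3, hPr⟩ := hq D hD hD4 (by omega)
    refine ⟨P, hPD, hP3, ?_⟩
    have h2 := rk_dual_add_rk_gr_eq (hPD.trans hD)
    omega
  have hmain := card_pdem_le_card_punit_of_quad h12 hR hll hqd hSd (card_singleton e)
  -- the demands are the bi-independent `5`-sets through `e`
  have eD : (biIndepSets N 5).filter (fun W => e ∈ W) = pdem (N✶) {e} := by
    ext W
    rw [mem_filter, mem_biIndepSets, mem_pdem, gr_dual, singleton_subset_iff]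
    constructor
    · rintro ⟨⟨hWg, hW5, hWr, hWc⟩, heW⟩
      have h := (biIndep_iff_dual_spanning hWg).1 ⟨hWr, hWc⟩
      rw [hR] at h
      exact ⟨hWg, hW5, heW, h.1, h.2⟩
    · rintro ⟨hWg, hW5, heW, h1, h2⟩
      have h := (biIndep_iff_dual_spanning hWg).2 (by rw [hR]; exact ⟨h1, h2⟩)
      exact ⟨⟨hWg, hW5, h.1, h.2⟩, heW⟩
  -- the units are the bi-independent `6`-sets avoiding `e`
  have eU : (biIndepSets N 6).filter (fun U => e ∉ U) = punit (N✶) {e} := by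
    ext U
    rw [mem_filter, mem_biIndepSets, mem_punit, gr_dual]
    have hUe : U ∩ {e} = ∅ ↔ e ∉ U := by
      rw [← disjoint_iff_inter_eq_empty, disjoint_singleton_right]
    rw [hUe]
    constructor
    · rintro ⟨⟨hUg, hU6, hUr, hUc⟩, heU⟩
      have h := (biIndep_iff_dual_spanning hUg).1 ⟨hUr, hUc⟩
      rw [hR] at h
      exact ⟨hUg, hU6, heU, h.1, h.2⟩
    · rintro ⟨hUg, hU6, heU, h1, h2⟩
      have h := (biIndep_iff_dual_spanning hUg).2 (by rw [hR]; exact ⟨h1, h2⟩)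
      exact ⟨⟨hUg, hU6, h.1, h.2⟩, heU⟩
  unfold inCount outCount
  rw [eD, eU]
  exact hmain

/-- **THE QUAD REGIME OF `InOutBottomTwelve`**: on every matroid with `12` points and rank `7` in which every `4`-set
`D` with `ρ(E ∖ D) = 5` contains a `3`-set `P` with `ρ(E ∖ P) = 5` (every co-rank-2 quadruple contains a series
triple), `in_5(e) ≤ out_6(e)` at every point `e` — a coloop `e` kills `in_5`, a coloop `x ≠ e` is deleted to the
rank-6 row where the two sides agree, and the coloop-free case is the dual count. -/
theorem inCount_five_le_outCount_six_of_twelve_of_quad (hn : (gr N).card = 12) (hR7 : rk N (gr N) = 7)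
    (hq : ∀ D ⊆ gr N, D.card = 4 → rk N (gr N \ D) = 5 → ∃ P ⊆ D, P.card = 3 ∧ rk N (gr N \ P) = 5)
    {e : α} (he : e ∈ gr N) : inCount N 5 e ≤ outCount N 6 e := by
  have hn5 : (gr N).card = rk N (gr N) + 5 := by omega
  -- `e` a coloop
  by_cases hce : rk N ((gr N).erase e) < rk N (gr N)
  · exact inCount_five_le_outCount_six_of_coloop hn5 hce
  -- a coloop `x ≠ e`
  by_cases hx : ∃ x ∈ (gr N).erase e, rk N ((gr N).erase x) < rk N (gr N)
  · obtain ⟨x, hx, hco⟩ := hx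
    have hxg : x ∈ gr N := (mem_erase.1 hx).2
    have hxe : x ≠ e := (mem_erase.1 hx).1
    have hrk : rk N ((gr N).erase x) + 1 = rk N (gr N) := by
      have := rk_le_rk_erase_add_one (M := N) (Subset.refl (gr N)) hxg
      omega
    have h1 := inCount_bottom_le_inCount_delete_of_coloop (ν := 5) (e := e) hn5 hco
    have h2 := outCount_delete_le_outCount_of_coloop' 6 (e := e) hxg hco
    have hn' : (gr (N ＼ ({x} : Set α))).card =
        rk (N ＼ ({x} : Set α)) (gr (N ＼ ({x} : Set α))) + 5 := by
      rw [gr_delete', card_erase_of_mem hxg, rk_delete (Subset.refl _)]; omega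
    have he' : e ∈ gr (N ＼ ({x} : Set α)) := by
      rw [gr_delete']; exact mem_erase.2 ⟨hxe.symm, he⟩
    have h3 := inCount_five_eq_outCount_six_of_rk_eq_six (N := N ＼ ({x} : Set α)) hn'
      (by rw [gr_delete', rk_delete (Subset.refl _)]; omega) he'
    omega
  · have hcf : ∀ x ∈ gr N, rk N ((gr N).erase x) = rk N (gr N) := by
      intro x hxg
      have hle := rk_mono' (M := N) (erase_subset x (gr N))
      by_cases hxe : x = e
      · rw [hxe] at hle ⊢; omega
      · have : ¬ rk N ((gr N).erase x) < rk N (gr N) := fun h => hx ⟨x, mem_erase.2 ⟨hxe, hxg⟩, h⟩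
        omega
    exact inCount_five_le_outCount_six_of_twelve_of_cf_of_quad hn hR7 hcf hq he

end TwelveQuadTransfer

end PercRepro.Cogirth
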